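import Mathlib
import HarnessLib
import Summits.NavierStokesRegularity.NavierStokesRegularity.Theorems.HalfSpaceWindowDoorCirculationCarryingRigidityDefs
import Summits.NavierStokesRegularity.NavierStokesRegularity.Theorems.HalfSpaceWindowDoorCirculationCarryingRigidityRotHeadOffAxis
import Summits.NavierStokesRegularity.NavierStokesRegularity.Theorems.HalfSpaceWindowDoorCirculationCarryingRigidityAsymptoticPlanarity
import Summits.NavierStokesRegularity.NavierStokesRegularity.Theorems.PoloidalWindowDoorPoloidalWindowRigidityWindow
import Summits.NavierStokesRegularity.NavierStokesRegularity.Theorems.PoloidalWindowDoorPoloidalWindowRigidityFlat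
import Summits.NavierStokesRegularity.NavierStokesRegularity.Theorems.PoloidalWindowDoorPoloidalWindowRigidityClassSpaceTimeRates
import Literature.Analysis.FluidPDE.TypeIAncientMildClassical
import Literature.Analysis.FluidPDE.VorticityCalculus

/-!
# Route `HalfSpaceWindowDoor`, crux `CirculationCarryingRigidity` (stmt-NavierStokesRegularity-25311) — line
# `rot_bernoulli`, IX: the GENERAL ONE-INSTANT ROW (any scaling rate, any vertex, any similarity drift, any α ≤ 0)

LEAD ns-hsw-p1 g11 (cell pub-ns-dss).  Final form of the one-instant rows of the line (`…InstantSelfSimilar`: `a = ½`,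
`x₀ = 0`, `α = 0`; `…RotHeadInstant`, `…RotHeadOffAxis`: `a = ½`).  A door-class profile `v` whose time derivative at the single
instant `t = −1` is the generator of a (rotated) self-similar motion about the space vertex `x₀`, with ANY scaling rate `a > 0`
(time vertex `−1 + 1/(2a)`), ANY constant similarity drift `c` and angular speed `α` about the vertical,

  `∂ₜv(−1,x) = a·v + a·((x − x₀)·∇)v + (c·∇)v + α(e₃×v − ((e₃×x)·∇)v)`   for all `x`,

with `(curl v(−1))₂ ≥ 0` and `α ≤ 0`, vanishes identically (`eq_zero_of_instantRSS_general`): the momentum equation at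
`t = −1` is then the rotated Leray system with rate `a` and constant drift `c − a x₀` for `U = v(−1)` and the classical
pressure (linearly growing), to which `…RotHeadOffAxis.exists_eq_const_of_rotProfile_drift` applies.  SIGN-FREE COROLLARY
(`α = 0`): `eq_zero_of_instantSelfSimilar_vertex` — NO door-class profile (of either door, cf. 19708) is instantaneously
self-similar about ANY space-time vertex with ANY rate (`a ≤ 0` is excluded for cause: `a < 0` is forward self-similarity,
where bounded profiles exist, and `a = 0` is instantaneous steadiness, whose Liouville problem is open).  By-name W6 forms:
`hemisphereLiouvilleE3_of_instantRSS_general`, `hemisphereLiouvilleE3_of_instantSelfSimilar_vertex`.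

WHAT THIS IS NOT: not a statement about Navier–Stokes regularity (Clay A); the door statements concern HYPOTHETICAL blow-up
profiles (KNSS ancient mild solutions); helper `--supports` 25311; the item stays OPEN at its research stub.
-/

noncomputable section

-- the summit and its single sub-problem share the name (CONVENTIONS §1), as in every Theorems file
set_option linter.dupNamespace false

namespace Summit.NavierStokesRegularity.NavierStokesRegularity.Theorems.HalfSpaceWindowDoorCirculationCarryingRigidityInstantVertex

open Set Function Filter Topology InnerProductSpace
open scoped RealInnerProductSpace Laplacian ContDiff
open Literature.Analysis Literature.Analysis.FluidPDE
open Summit.NavierStokesRegularity.NavierStokesRegularity.Theorems.HalfSpaceWindowDoorCirculationCarryingRigidityDefs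
  (InDoorClass SignE3 e3 HemisphereLiouvilleE3)
open Summit.NavierStokesRegularity.NavierStokesRegularity.Theorems.HalfSpaceWindowDoorCirculationCarryingRigidityRotHeadOffAxis
  (exists_eq_const_of_rotProfile_drift)
open Summit.NavierStokesRegularity.NavierStokesRegularity.Theorems.HalfSpaceWindowDoorCirculationCarryingRigidityRotHead
  (rotGenL_skew traceCLM_rotGenL_comp_fderiv)
open Summit.NavierStokesRegularity.NavierStokesRegularity.Theorems.HalfSpaceWindowDoorCirculationCarryingRigidityAsymptoticPlanarity
  (eq_zero_of_lineInvariant_slice)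
open Summit.NavierStokesRegularity.NavierStokesRegularity.Theorems.PoloidalWindowDoorPoloidalWindowRigidityWindow
  (isTypeIAncientMild_of_class)
open Summit.NavierStokesRegularity.NavierStokesRegularity.Theorems.PoloidalWindowDoorPoloidalWindowRigidityClassSpaceTimeRates
  (exists_pressureGradient_rate_of_class)
open Summit.NavierStokesRegularity.NavierStokesRegularity.Theorems.PoloidalWindowDoorPoloidalWindowRigidityFlat
  (not_backwardSingular_of_zero)

variable {C : ℝ} {v : ℝ → EuclideanSpace ℝ (Fin 3) → EuclideanSpace ℝ (Fin 3)}

/-- **The general one-instant row.**  Door class + `(curl v(−1))₂ ≥ 0` +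
`∂ₜv(−1,x) = a·v(−1,x) + a·((x − x₀)·∇)v(−1,x) + (c·∇)v(−1,x) + α(e₃×v(−1,x) − ((e₃×x)·∇)v(−1,x))` for all `x`, with `a > 0`
and `α ≤ 0` ⇒ `v ≡ 0` on the slab. -/
theorem eq_zero_of_instantRSS_general (hv : InDoorClass C v) (hsign : ∀ y, 0 ≤ curl (v (-1)) y 2) {a α : ℝ} (ha : 0 < a)
    (hα : α ≤ 0) (x₀ c : EuclideanSpace ℝ (Fin 3))
    (hgen : ∀ x, deriv (fun τ => v τ x) (-1) = a • v (-1) x + a • fderiv ℝ (v (-1)) x (x - x₀) +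
      fderiv ℝ (v (-1)) x c + α • (rotGen (v (-1) x) - fderiv ℝ (v (-1)) x (rotGen x))) :
    ∀ t < 0, ∀ x, v t x = 0 := by
  obtain ⟨hrate, hcont, hmild, hdiv⟩ := hv
  have hA : IsTypeIAncientMild C v := isTypeIAncientMild_of_class hrate hcont hmild hdiv
  have h1 : (-1 : ℝ) < 0 := by norm_num
  have hmem : (-1 : ℝ) ∈ Ioo (-2 : ℝ) 0 := ⟨by norm_num, by norm_num⟩
  set U : EuclideanSpace ℝ (Fin 3) → EuclideanSpace ℝ (Fin 3) := v (-1) with hU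
  have hU3 : ContDiff ℝ 3 U := contDiff_infty.1 (hA.contDiff_slice h1) 3
  have hdivU : VectorCalculus.IsDivFree U := hdiv (-1) h1
  have hUbdd : ∃ M : ℝ, ∀ y, ‖U y‖ ≤ M := ⟨C, fun y => by
    have h := hA.norm_le h1 y
    rwa [neg_neg, Real.sqrt_one, div_one] at h⟩
  obtain ⟨p, hns⟩ := hA.exists_isClassicalNSSolutionOn_Ioo (t₀ := -2) (by norm_num)
  obtain ⟨K, hK0, hK⟩ := exists_pressureGradient_rate_of_class hrate hcont hmild
  have hgradK : ∀ y, ‖gradient (p (-1)) y‖ ≤ K := fun y => by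
    have h := hK (-2) p hns (-1) hmem y
    rwa [neg_neg, Real.sqrt_one, mul_one, div_one] at h
  have hP2 : ContDiff ℝ 2 (p (-1)) := (hns.contDiff_pressure hmem).of_le (by norm_cast)
  have hPd : Differentiable ℝ (p (-1)) := (hP2.of_le one_le_two).differentiable one_ne_zero
  have hfd : ∀ z, ‖fderiv ℝ (p (-1)) z‖ ≤ K := fun z => by
    refine ContinuousLinearMap.opNorm_le_bound _ hK0 fun w => ?_
    have h : fderiv ℝ (p (-1)) z w = ⟪gradient (p (-1)) z, w⟫ := by
      rw [gradient, InnerProductSpace.toDual_symm_apply]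
    rw [h]
    exact (abs_real_inner_le_norm _ _).trans (mul_le_mul_of_nonneg_right (hgradK z) (norm_nonneg _))
  have hPpoly : ∃ K' : ℝ, ∃ N : ℕ, ∀ y, |p (-1) y| ≤ K' * (1 + ‖y‖) ^ N := by
    refine ⟨|p (-1) 0| + K, 1, fun y => ?_⟩
    have hmv : ‖p (-1) y - p (-1) 0‖ ≤ K * ‖y - 0‖ :=
      (convex_univ).norm_image_sub_le_of_norm_fderiv_le (fun z _ => hPd z) (fun z _ => hfd z) (mem_univ 0) (mem_univ y)
    rw [sub_zero, Real.norm_eq_abs] at hmv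
    have h2 : |p (-1) y| ≤ |p (-1) 0| + K * ‖y‖ := by
      have := abs_sub_abs_le_abs_sub (p (-1) y) (p (-1) 0)
      linarith
    rw [pow_one]
    nlinarith [abs_nonneg (p (-1) 0), norm_nonneg y]
  -- the rotated Leray system with rate `a` and the constant drift `c − a x₀`
  have heq : ∀ y, -((1 : ℝ) • (Δ U) y) + a • U y + a • fderiv ℝ U y y + fderiv ℝ U y (c - a • x₀) + convect U U y +
      gradient (p (-1)) y + α • (rotGenL (U y) - fderiv ℝ U y (rotGenL y)) = 0 := fun y => by
    have hmom := hns.momentum (-1) hmem y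
    simp only [one_smul, Pi.zero_apply, add_zero] at hmom
    have htd : timeDerivWithin (Ioo (-2 : ℝ) 0) v (-1) y = deriv (fun τ => v τ y) (-1) := by
      rw [timeDerivWithin, derivWithin_of_isOpen isOpen_Ioo hmem]
    rw [htd, hgen y] at hmom
    simp only [← rotGenL_apply, map_sub, smul_sub] at hmom
    rw [← sub_eq_zero] at hmom
    rw [one_smul, map_sub, map_smul, ← hmom]
    simp only [smul_sub]
    abel
  obtain ⟨c₀, hc₀⟩ := exists_eq_const_of_rotProfile_drift one_pos ha rotGenL_skew (c - a • x₀) hU3 hP2 hdivU heq hUbdd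
    hPpoly (fun y => by
      rw [traceCLM_rotGenL_comp_fderiv, mul_neg]
      exact neg_nonneg.2 (mul_nonpos_of_nonpos_of_nonneg hα (hsign y)))
  have he3 : e3 ≠ 0 := fun h => by
    have h2 := congrArg (fun w : EuclideanSpace ℝ (Fin 3) => w 2) h
    simp [e3] at h2
  exact eq_zero_of_lineInvariant_slice hA h1 he3 fun x θ => by
    change U (x + θ • e3) = U x
    rw [hc₀, hc₀]

/-- **SIGN-FREE: no door-class profile is instantaneously self-similar about ANY vertex, at ANY rate.**  Door class (no sign
hypothesis) + `∂ₜv(−1,x) = a·v(−1,x) + a·((x − x₀)·∇)v(−1,x)` for all `x`, some `a > 0` and `x₀` (the generator of Leray's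
scaling about the space-time vertex `(x₀, −1 + 1/(2a))`) ⇒ `v ≡ 0`. -/
theorem eq_zero_of_instantSelfSimilar_vertex (hv : InDoorClass C v) {a : ℝ} (ha : 0 < a) (x₀ : EuclideanSpace ℝ (Fin 3))
    (hgen : ∀ x, deriv (fun τ => v τ x) (-1) = a • v (-1) x + a • fderiv ℝ (v (-1)) x (x - x₀)) :
    ∀ t < 0, ∀ x, v t x = 0 := by
  -- the case `α = 0`, `c = 0` of the general row; the sign hypothesis is then only used multiplied by `α = 0`,
  -- so we may run the drift Liouville theorem directly without it
  obtain ⟨hrate, hcont, hmild, hdiv⟩ := hv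
  have hA : IsTypeIAncientMild C v := isTypeIAncientMild_of_class hrate hcont hmild hdiv
  have h1 : (-1 : ℝ) < 0 := by norm_num
  have hmem : (-1 : ℝ) ∈ Ioo (-2 : ℝ) 0 := ⟨by norm_num, by norm_num⟩
  set U : EuclideanSpace ℝ (Fin 3) → EuclideanSpace ℝ (Fin 3) := v (-1) with hU
  have hU3 : ContDiff ℝ 3 U := contDiff_infty.1 (hA.contDiff_slice h1) 3
  have hdivU : VectorCalculus.IsDivFree U := hdiv (-1) h1
  have hUbdd : ∃ M : ℝ, ∀ y, ‖U y‖ ≤ M := ⟨C, fun y => by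
    have h := hA.norm_le h1 y
    rwa [neg_neg, Real.sqrt_one, div_one] at h⟩
  obtain ⟨p, hns⟩ := hA.exists_isClassicalNSSolutionOn_Ioo (t₀ := -2) (by norm_num)
  obtain ⟨K, hK0, hK⟩ := exists_pressureGradient_rate_of_class hrate hcont hmild
  have hgradK : ∀ y, ‖gradient (p (-1)) y‖ ≤ K := fun y => by
    have h := hK (-2) p hns (-1) hmem y
    rwa [neg_neg, Real.sqrt_one, mul_one, div_one] at h
  have hP2 : ContDiff ℝ 2 (p (-1)) := (hns.contDiff_pressure hmem).of_le (by norm_cast)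
  have hPd : Differentiable ℝ (p (-1)) := (hP2.of_le one_le_two).differentiable one_ne_zero
  have hfd : ∀ z, ‖fderiv ℝ (p (-1)) z‖ ≤ K := fun z => by
    refine ContinuousLinearMap.opNorm_le_bound _ hK0 fun w => ?_
    have h : fderiv ℝ (p (-1)) z w = ⟪gradient (p (-1)) z, w⟫ := by
      rw [gradient, InnerProductSpace.toDual_symm_apply]
    rw [h]
    exact (abs_real_inner_le_norm _ _).trans (mul_le_mul_of_nonneg_right (hgradK z) (norm_nonneg _))
  have hPpoly : ∃ K' : ℝ, ∃ N : ℕ, ∀ y, |p (-1) y| ≤ K' * (1 + ‖y‖) ^ N := by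
    refine ⟨|p (-1) 0| + K, 1, fun y => ?_⟩
    have hmv : ‖p (-1) y - p (-1) 0‖ ≤ K * ‖y - 0‖ :=
      (convex_univ).norm_image_sub_le_of_norm_fderiv_le (fun z _ => hPd z) (fun z _ => hfd z) (mem_univ 0) (mem_univ y)
    rw [sub_zero, Real.norm_eq_abs] at hmv
    have h2 : |p (-1) y| ≤ |p (-1) 0| + K * ‖y‖ := by
      have := abs_sub_abs_le_abs_sub (p (-1) y) (p (-1) 0)
      linarith
    rw [pow_one]
    nlinarith [abs_nonneg (p (-1) 0), norm_nonneg y]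
  have heq : ∀ y, -((1 : ℝ) • (Δ U) y) + a • U y + a • fderiv ℝ U y y + fderiv ℝ U y (-(a • x₀)) + convect U U y +
      gradient (p (-1)) y + (0 : ℝ) • (rotGenL (U y) - fderiv ℝ U y (rotGenL y)) = 0 := fun y => by
    have hmom := hns.momentum (-1) hmem y
    simp only [one_smul, Pi.zero_apply, add_zero] at hmom
    have htd : timeDerivWithin (Ioo (-2 : ℝ) 0) v (-1) y = deriv (fun τ => v τ y) (-1) := by
      rw [timeDerivWithin, derivWithin_of_isOpen isOpen_Ioo hmem]
    rw [htd, hgen y, map_sub, smul_sub] at hmom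
    rw [← sub_eq_zero] at hmom
    simp only [one_smul, zero_smul, add_zero, map_neg, map_smul]
    rw [← hmom]
    abel
  obtain ⟨c₀, hc₀⟩ := exists_eq_const_of_rotProfile_drift one_pos ha rotGenL_skew (-(a • x₀)) hU3 hP2 hdivU heq hUbdd
    hPpoly (fun y => by rw [zero_mul])
  have he3 : e3 ≠ 0 := fun h => by
    have h2 := congrArg (fun w : EuclideanSpace ℝ (Fin 3) => w 2) h
    simp [e3] at h2
  exact eq_zero_of_lineInvariant_slice hA h1 he3 fun x θ => by
    change U (x + θ • e3) = U x
    rw [hc₀, hc₀]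

/-- … hence NOT backward singular at the apex (sign-free). -/
theorem not_isBackwardSingularPoint_of_instantSelfSimilar_vertex (hv : InDoorClass C v) {a : ℝ} (ha : 0 < a)
    (x₀ : EuclideanSpace ℝ (Fin 3))
    (hgen : ∀ x, deriv (fun τ => v τ x) (-1) = a • v (-1) x + a • fderiv ℝ (v (-1)) x (x - x₀)) :
    ¬ IsBackwardSingularPoint v 0 :=
  not_backwardSingular_of_zero (eq_zero_of_instantSelfSimilar_vertex hv ha x₀ hgen)

/-- **W6 = `HemisphereLiouvilleE3` RESTRICTED TO THE GENERAL ONE-INSTANT STRATUM** (hypotheses of `HemisphereLiouvilleE3` verbatim +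
the one-instant identity with `a > 0`, `α ≤ 0`, any `x₀`, `c`). -/
theorem hemisphereLiouvilleE3_of_instantRSS_general (C : ℝ) (v : ℝ → EuclideanSpace ℝ (Fin 3) → EuclideanSpace ℝ (Fin 3))
    (hrate : HasTypeITimeDecay C v) (hcont : ContinuousOn (Function.uncurry v) (Set.Iio (0 : ℝ) ×ˢ Set.univ))
    (hmild : ∀ s t : ℝ, s < t → t < 0 → ∀ x,
      v t x = UnboundedOperators.heatExtension (v s) (t - s) x - oseenDuhamel 1 s v v t x)
    (hdiv : ∀ t < 0, VectorCalculus.IsDivFree (v t)) (hsign : ∀ s < 0, ∀ y, 0 ≤ ⟪curl (v s) y, e3⟫)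
    {a α : ℝ} (ha : 0 < a) (hα : α ≤ 0) (x₀ c : EuclideanSpace ℝ (Fin 3))
    (hgen : ∀ x, deriv (fun τ => v τ x) (-1) = a • v (-1) x + a • fderiv ℝ (v (-1)) x (x - x₀) +
      fderiv ℝ (v (-1)) x c + α • (rotGen (v (-1) x) - fderiv ℝ (v (-1)) x (rotGen x))) :
    ∀ s < 0, ∀ y, ⟪curl (v s) y, e3⟫ = 0 := by
  have hsign1 : ∀ y, 0 ≤ curl (v (-1)) y 2 := fun y => by
    simpa [e3, EuclideanSpace.inner_single_right] using hsign (-1) (by norm_num) y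
  intro s hs y
  have hz : v s = 0 :=
    funext fun x => eq_zero_of_instantRSS_general ⟨hrate, hcont, hmild, hdiv⟩ hsign1 ha hα x₀ c hgen s hs x
  rw [hz, curl_zero]
  simp

/-- **W6 = `HemisphereLiouvilleE3` RESTRICTED TO INSTANTANEOUSLY SELF-SIMILAR PROFILES (any vertex, any rate)** — the sign is idle. -/
theorem hemisphereLiouvilleE3_of_instantSelfSimilar_vertex (C : ℝ)
    (v : ℝ → EuclideanSpace ℝ (Fin 3) → EuclideanSpace ℝ (Fin 3))
    (hrate : HasTypeITimeDecay C v) (hcont : ContinuousOn (Function.uncurry v) (Set.Iio (0 : ℝ) ×ˢ Set.univ))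
    (hmild : ∀ s t : ℝ, s < t → t < 0 → ∀ x,
      v t x = UnboundedOperators.heatExtension (v s) (t - s) x - oseenDuhamel 1 s v v t x)
    (hdiv : ∀ t < 0, VectorCalculus.IsDivFree (v t)) (_hsign : ∀ s < 0, ∀ y, 0 ≤ ⟪curl (v s) y, e3⟫)
    {a : ℝ} (ha : 0 < a) (x₀ : EuclideanSpace ℝ (Fin 3))
    (hgen : ∀ x, deriv (fun τ => v τ x) (-1) = a • v (-1) x + a • fderiv ℝ (v (-1)) x (x - x₀)) :
    ∀ s < 0, ∀ y, ⟪curl (v s) y, e3⟫ = 0 := by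
  intro s hs y
  have hz : v s = 0 := funext fun x => eq_zero_of_instantSelfSimilar_vertex ⟨hrate, hcont, hmild, hdiv⟩ ha x₀ hgen s hs x
  rw [hz, curl_zero]
  simp

end Summit.NavierStokesRegularity.NavierStokesRegularity.Theorems.HalfSpaceWindowDoorCirculationCarryingRigidityInstantVertex

end
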